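import Literature.MathematicalPhysics.QuantumFieldTheory.Balaban1983to89.B15Claim189FlowAtRecord

/-!
# BalabanUVNodes ∕ N12 — TWO ADAPTERS FOR THE «WINDOW-LOCAL ROWS» EDITION OF N12's JUNCTION ∕ h12 BILL: `β₀ ≤ ½` from NODE O's smallness, and [III] (2.8a) along a generated history IN 12P §1's `ℕ`-CAST SPELLING

Cell `pub-ymgap` (HUMAN RULING D-0062), seat `pub-ymgap-dag-n12-d` g39 (R134 N12 [B15] s2 «knit at the record»); helper of K1ᴬ `stmt-QuantumFields-27239`, `--kind proof --supports … --as
helper`, count-neutral.  Consumed by `BalabanUVNodesN12AtRecord13Prop1KnitThm1WindowLocalRowsOfClassOnlyRowL1NearRadiusDatumScaleAtLengthOfRecordBTermPinnedChi` (LOCATED-g39-1: 12P §1's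
per-run coupling rows `tlog tε0 tε1 tflow` are paid INSIDE the run's window from Θ-level numerics).  BY NAME and UNCHANGED: dag-n12-e's `B15Claim189FlowAtRecord.epsOfRecord_flow28a_of_inInterval`
([III] (2.8), first member, along `genSeq β g₀` in the window with the BOX bound `β ≤ β′`), `betaAlongHistory_le_of_betaUpperH`; `B14FlowStep.SmallnessFor`; `Step.InInterval`; [Balaban1987RG1] Thm 1 p.259 (the window).

HONEST FRAMING.  Two one-line bookkeeping lemmas (an arithmetic consequence of `Lβ₀ ≤ 1 ∧ 2 ≤ L`, a `Nat.cast_sub` rewrite); the window restricted to the step is def-Y's `Node00.inInterval_of_le` (`Node00/Record12ContTResidue`); nothing of Bałaban's asserted; N12 NOT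
discharged; counts unmoved (discharged 8∕27 · K 1∕4); finite 𝕋⁴ at fixed ε — NOT continuum ∕ OS ∕ Clay.  THEOREMS ONLY (0 `def`, 0 `instance`, 0 `sorry`).
Sources (bookkeeping only): [Balaban1988Convergent] (2.4) p.255, (2.7)–(2.9) pp.255–256; [Balaban1987RG1] §1 p.264 (`β ≤ β′`);
[Balaban1989LargeFieldI] p.199 (the units inequality `ε_k ≤ (1+β₀)(k−j)^{1/2}ε_j`).
-/

noncomputable section

namespace Summit.QuantumFields.YangMills.BalabanUVNodes.N12FlowRowsOfWindowAdapters

open Literature.MathematicalPhysics.QuantumFieldTheory.Balaban1983to89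
open Literature.MathematicalPhysics.QuantumFieldTheory.Balaban1983to89.Node00
open FlowStep (HBeta BetaUpperH)
open FlowStepRuns (genSeq)
open B14FlowStep (SmallnessFor)
open B15Claim189FlowAtRecord (epsOfRecord_flow28a_of_inInterval betaAlongHistory_le_of_betaUpperH)

/-- `SmallnessFor γ β′ β₀ L p` carries `Lβ₀ ≤ 1` with `2 ≤ L`, hence `β₀ ≤ ½` (12P §1's row `tβ₀`). [cite: Balaban1988Convergent, (2.9) p.256 (bookkeeping)] -/
theorem beta0_le_half_of_smallnessFor {γ β' β₀ : ℝ} {L p : ℕ} (S : SmallnessFor γ β' β₀ L p) : β₀ ≤ 1 / 2 := by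
  have hL : (2 : ℝ) ≤ (L : ℝ) := by exact_mod_cast S.hL
  have h := S.h29c
  have hβ := S.β₀_pos.le
  nlinarith

/-- **(2.8a) IN 12P §1's SPELLING, FROM THE WINDOW** — dag-n12-e's `B15Claim189FlowAtRecord.epsOfRecord_flow28a_of_inInterval` (first member of [III] (2.8) along a generated history in
the window `]0, γ]` up to `K`, with the BOX bound `β ≤ β′` through `betaAlongHistory_le_of_betaUpperH`) read at the top level `n + 1 ≤ K` against the levels `j < n + 1`, with the
`ℕ`-cast square root `√((n + 1 − j : ℕ))` of the term-pinned leaf's row `hflow` (`Nat.cast_sub`). [cite: Balaban1988Convergent, (2.8) p.256; Balaban1989LargeFieldI, p.199] -/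
theorem flow28a_natCast_of_inInterval (ν : Stage7Numerics) (hA₀ : 0 ≤ ν.A₀) {γ β' β₀ : ℝ} {L : ℕ} (S : SmallnessFor γ β' β₀ L ν.p₀) (β : HBeta) (g0 : ℝ)
    {K n : ℕ} (hn : n < K) (hI : Step.InInterval γ K (genSeq β g0)) (hup : BetaUpperH β' γ β) (Nm : ℕ) :
    ∀ j, n + 1 - Nm ≤ j → j < n + 1 →
      epsOfRecord ν (genSeq β g0) (n + 1) ≤ (1 + β₀) * Real.sqrt ((n + 1 - j : ℕ) : ℝ) * epsOfRecord ν (genSeq β g0) j := by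
  intro j _ hj
  have h := epsOfRecord_flow28a_of_inInterval ν hA₀ S β g0 hI (betaAlongHistory_le_of_betaUpperH hup hI) hj (Nat.succ_le_of_lt hn)
  rw [Nat.cast_sub hj.le]
  exact h

end Summit.QuantumFields.YangMills.BalabanUVNodes.N12FlowRowsOfWindowAdapters

end
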